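import Literature.MathematicalPhysics.QuantumFieldTheory.Balaban1983to89.B9Thm37TransposedCommutator
import Literature.MathematicalPhysics.QuantumFieldTheory.Balaban1983to89.B9Thm37GpTorusRegularEntriesCubes

/-!
# `Balaban1983to89.B9Thm37TransposedCommutatorMajorant` — T. Bałaban, *Propagators for lattice gauge theories in a background field*, Commun. Math.
# Phys. **99** (1985) 389–434 [Balaban1985BackgroundPropagators], Sect. C pp. 409–410: the SCALE-WEIGHTED block majorant of the transposed commutator term
# `V_□ = −h_□G′_□K(h_□)` ([4] (2.51)), and Theorem 3.7 ⇒ ALL FOUR (3.42) entries for `G′(U)` at the cube cover of record with the `hV`∕`hKV` inputs of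
# `B9Thm37GpTorusRegularEntries`∕`…EntriesCubes` DISCHARGED

statement-level skeleton of published theorems with citation tags; proofs where landed; nothing here is a claim about the Yang–Mills mass gap

PDF held: `paper:balaban1985-cmp99-background-propagators` (journal page = PDF page + 388); pp. 397, 403, 408–410 read from the held text layer;
[4] = [Balaban1984PropagatorsII] pp. 224, 232, 234–235.

THE PRINT.  p. 409 (3.87)–(3.90); p. 410: *«This theorem follows simply from Corollary 3.6 holding for all G′_□ and from the geometric properties of the
partition … Theorem 3.7 implies that all the inequalities (3.42)–(3.47) hold for G′, thus we have completed the proof of Theorem 3.1»*; Thm 3.1 (3.42) p. 397;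
p. 403 *«of course with different constants»*; [4] (2.51) p. 232, Prop. 2.2 (2.65)–(2.67) p. 234, (2.2) p. 224 with p. 235 (the window of `□⁺`).

WHY THIS FILE (cell context: G-B9-LETTERS, module M5.5 FILE 5b; consumers = M5.9 `LettersAt` fields gp_sup∕grad∕div∕lap).  FILE 4c
`B9Thm37GpTorusRegularEntriesCubes.eBlock_kernelFamilySInv_Gp_of_cubeCover` left the transposed commutator family `V_□` abstract, asking for block majorants
`K_{V,□}` whose sum is scale-weighted, `≤ θ_V·ℓ(a)ℓ(a′)⁻¹e^{−δ₀d(a,a′)}` (`hV`, `hKV` — the input of r06's scale-weighted left fixed point for the right entry).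
From FILE 5a's transposed (3.89) `‖h_□(z)·O_□(K(h_□)Λ)(z)‖ ≤ θ_T·e^{−δ₀d(y,y′)}|f|` and its input vanishing beyond the window, §1 gives the conjugated term
`conj b V_□`, `V_□Λ = −h_□O_□(K(h_□)Λ)`, the majorant `1_{S_□}(a)·M₂(Σ‖b_j‖)·θ_T·L⁴·ℓ(a)ℓ(a′)⁻¹·e^{−δ₀d(a,a′)}` (the output block `βa ∈ QT □` has level
`≥ j − 1`, the input block has level `≤ j + 3`, so `ℓ(a)∕ℓ(a′) ≥ L⁻⁴`), and §2 feeds it to FILE 4c: ★★ `eBlock_kernelFamilySInv_Gp_of_cubeCover'` — the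
(3.42) block of the reading of `G′(U)` over the invariant class at `U₁` with `V_□ := −h_□O_□K(h_□)` CONCRETE (`hVt`) and its majorants DISCHARGED; what
stays displayed is exactly what print's p. 410 sentence leaves to «Corollary 3.6 holding for all G′_□» and the algebra of pp. 409–410: `G′Δ′_a = 1` (`hinv`), (3.88) (`h388`, p38's
`B9Thm37CubeCoverCommutators.eq388_hT` under the local-inverse property) and its transposed reading (`h388T`, FILE 5a `eq388T_hT'` under the right
local-inverse property), the bond variables ∕ averaging transporters bi-contractive at `U₁`, `η = |c_f|⁻¹`, the neighbourhood count `m_N` ([4] (2.61)),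
[4] Lemma 2.1 at exponent `α`, and the two located smallness conditions («M sufficiently large»).

WHAT IS PROVED (all `theorem`s, no `sorry`).  §1 `smul_comm_of_eq_transposed`, `one_le_pow_four_mul_len_ratio`, ★★ `hasMajorant_conj_transposedComm`;
§2 ★★ `eBlock_kernelFamilySInv_Gp_of_cubeCover'`.
-/

noncomputable section

namespace Literature.MathematicalPhysics.QuantumFieldTheory.Balaban1983to89.B9Thm37TransposedCommutatorMajorant

open Node00 B9CubeLettersInvReadings B9CubeLettersInvReadDict
open B9Thm37GpTorusRegularCubes (SQT mem_SQT hcnt_SQT)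
open B9Thm37GpTorusRegularEntriesCubes (sum_ite_SQT_le eBlock_kernelFamilySInv_Gp_of_cubeCover)
open B9Thm37TransposedCommutator (norm_hTY_O_KhY_apply_le KhY_hTY_eq_zero_of_far lvl_ge_of_mem_QT)
open B9Thm37CutoffDivTerms (mem_QT_of_cutMulY_ne_zero)
open B9Thm37CubeCoverCommutators (cutMulY cutMulY_apply hTY KhY)
open B9Thm37CubeCoverCommutatorSizes (side_conditions four_le_P')
open B9Thm37CommutatorBound389 (theta389 theta389_nonneg geo9K_len_eq)
open B9Thm37CommutatorBound389Majorant (norm_liftY_le)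
open B6Geom246MultiLevelBox (bset blkOf)
open B6Cover236MultiLevelBlocks (cubes)
open B6Partition118KLevelTorusCentral (QT)
open B6Partition118KLevelFineSizes (C1F C1F_nonneg)
open B6Partition118KLevelFineSecond (C2F C2F_nonneg)
open B6Partition118KLevelTorusBinders (sLipT sLipT_nonneg)
open B6Ineq2142KLevelV1 (β lvl beta_level)
open B6KLevelCensusIndexV1 (KIdx)
open B6RandomWalk (HasMajorant Triangle254 Ineq261 Ineq263 hasMajorant_mono)
open B9Thm34Ext (toB6)
open B9FromB6 (EBlock)
open B9GeoNormsKLevelV1 (geo9K geo9K_supNorm_nonneg)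
open B9Eq352DivFormLetters (conj)
open B9Ineq349SiteComposite (etaS_pos)
open scoped Matrix

variable {d ℓ : ℕ} {hd : 1 ≤ d + 1} {hL : Odd (ℓ + 1) ∧ 1 < ℓ + 1} {b₀ b₁ : ℝ}
variable {𝔸 : Type} [NormedRing 𝔸] [NormedAlgebra ℂ 𝔸] [CompleteSpace 𝔸]
variable {ι : Type} [Fintype ι] [DecidableEq ι]
variable (i : KIdx d ℓ hd hL b₀ b₁) (b : Module.Basis ι ℝ 𝔸)

/-! ## §1 The scale-weighted block majorant of `conj b V_□`, `V_□Λ = −h_□O_□(K(h_□)Λ)` -/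

section Majorant

variable (V : CfgY 𝔸 i) (O : (SiteY i → 𝔸) →ₗ[ℂ] (SiteY i → 𝔸)) (par : SiteParY 𝔸 i) {B₀ δ : ℝ}
variable [Fintype (geo9K i).Site] {Rr : ℝ} {Hp : Prop}

omit [DecidableEq ι] [Fintype (geo9K i).Site] in
/-- an ℝ-linear `Rl` agreeing with `Λ ↦ −h_□O(K(h_□)Λ)` is ℂ-homogeneous. [cite: Balaban1985BackgroundPropagators, (3.88) p.409, bookkeeping] -/
theorem smul_comm_of_eq_transposed (c : ↥(cubes i.D.toDomains)) (Rl : Module.End ℝ (SiteY i → 𝔸))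
    (hRl : ∀ Λ z, Rl Λ z = -(cutMulY (hTY i c) (O (KhY i par (hTY i c) V Λ)) z)) (a : ℂ) (Λ : SiteY i → 𝔸) :
    Rl (a • Λ) = a • Rl Λ := by
  funext z
  rw [hRl, Pi.smul_apply, hRl, map_smul, map_smul, map_smul, Pi.smul_apply, smul_neg]

omit [NormedRing 𝔸] [NormedAlgebra ℂ 𝔸] [CompleteSpace 𝔸] [Fintype ι] [DecidableEq ι] [Fintype (geo9K i).Site] in
/-- **THE SCALE WEIGHT ACROSS THE WINDOW**: if `lvl(a′) ≤ lvl(a) + 4` then `1 ≤ L⁴·ℓ(a)·ℓ(a′)⁻¹` (`ℓ = L^{lvl}·|c_f|⁻¹`).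
[cite: Balaban1984PropagatorsII, (2.1) p.224, (2.2) p.224, bookkeeping] -/
theorem one_le_pow_four_mul_len_ratio (hη : etaS i = |i.cf|⁻¹) {a a' : IBondY i}
    (h : lvl i.hN i.D i.hk a' ≤ lvl i.hN i.D i.hk a + 4) :
    1 ≤ ((ℓ : ℝ) + 1) ^ 4 * (geo9K i).len a * ((geo9K i).len a')⁻¹ := by
  have hL1 : (1 : ℝ) ≤ (ℓ : ℝ) + 1 := by linarith [(Nat.cast_nonneg ℓ : (0 : ℝ) ≤ ℓ)]
  have hcf : 0 < |i.cf| := by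
    have h0 : 0 < |i.cf|⁻¹ := by rw [← hη]; exact etaS_pos i
    exact inv_pos.mp h0
  have hla' : 0 < (geo9K i).len a' := B6KLevelCensusIndexV1.len_pos i a'
  rw [mul_assoc, ← div_eq_mul_inv, ← mul_div_assoc, one_le_div₀ hla', geo9K_len_eq, geo9K_len_eq]
  push_cast
  rw [mul_div_assoc', div_le_div_iff_of_pos_right hcf, ← pow_add]
  exact pow_le_pow_right₀ hL1 (by omega)

omit [DecidableEq ι] in
/-- ★★ **THE `KV □` SLOT OF FILE 2∕4c: the scale-weighted block majorant of the conjugated transposed commutator term** — for a cube letter `O` with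
(3.42)₁,₃ displayed over the class, the cut-off `h_□` of the partition of record, `η = |c_f|⁻¹`, `0 ≤ δ`, bi-contractive bond variables and averaging
transporters, at most `m_N` index bonds within `1` of a bond, a real basis `b` (coordinate bound `M₂`), a corner-free section `ιB`, an ℝ-linear `Rl` with
`RlΛ = −h_□O(K(h_□)Λ)` and ANY `S ⊇ {a : βa ∈ QT □}`: `conj b Rl` has the majorant `1[a ∈ S]·M₂(Σ_j‖b_j‖)·θ_T·L⁴·ℓ(a)·ℓ(a′)⁻¹·e^{−δd(a,a′)}`
(FILE 5a's `θ_T`; the term vanishes unless `βa ∈ QT □` — level `≥ j − 1` — and `lvl(a′) ≤ j + 3`, whence `ℓ(a)∕ℓ(a′) ≥ L⁻⁴`).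
[cite: Balaban1985BackgroundPropagators, (3.88)–(3.89) p.409, (3.42) p.397; Balaban1984PropagatorsII, (2.51) p.232, (2.2) p.224, p.235] -/
theorem hasMajorant_conj_transposedComm (c : ↥(cubes i.D.toDomains)) (hB₀ : 0 ≤ B₀) (hδ : 0 ≤ δ) (hη : etaS i = |i.cf|⁻¹)
    (ιB : BlkY i → IBondY i) (hι : ∀ s, β i.hN i.D i.hk (ιB s) = s)
    (hV : ∀ (μ : Fin (d + 1)) (x : SiteY i), ‖(UboxY i V μ x : 𝔸)‖ ≤ 1 ∧ ‖(((UboxY i V μ x)⁻¹ : 𝔸ˣ) : 𝔸)‖ ≤ 1)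
    (hTr : ∀ z w : SiteY i, ‖(avgTrY i par V z w : 𝔸)‖ ≤ 1 ∧ ‖(((avgTrY i par V z w)⁻¹ : 𝔸ˣ) : 𝔸)‖ ≤ 1)
    (h342₀ : ∀ (f : SiteY i → ℝ) (y y' : IBondY i), (geo9K i).suppIn (Sum.inl f) y' →
      ∀ Λ : SiteY i → 𝔸, (∀ z, ‖Λ z‖ ≤ |f z|) → ∀ z : SiteY i, blkOf i.D.toDomains z = β i.hN i.D i.hk y →
        etaS i ^ 2 * ‖O Λ z‖ ≤ B₀ * (geo9K i).len y ^ 2 * Real.exp (-(δ * (geo9K i).dist y y')) * (geo9K i).supNorm (Sum.inl f))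
    (h342₂ : ∀ (f : SiteY i → ℝ) (y y' : IBondY i), (geo9K i).suppIn (Sum.inl f) y' →
      ∀ Λ : SiteY i → 𝔸, (∀ z, ‖Λ z‖ ≤ |f z|) → ∀ (z : SiteY i) (μ : Fin (d + 1)), blkOf i.D.toDomains z = β i.hN i.D i.hk y →
        etaS i * ‖O (cdsS i V μ Λ) z‖ ≤ B₀ * (geo9K i).len y * Real.exp (-(δ * (geo9K i).dist y y')) * (geo9K i).supNorm (Sum.inl f))
    (T : IBondY i → Finset (IBondY i)) (hT : ∀ a y' : IBondY i, (geo9K i).dist a y' ≤ 1 → a ∈ T y')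
    {mN : ℕ} (hnbr : ∀ y' : IBondY i, (T y').card ≤ mN)
    {M₂ : ℝ} (hM₂ : 0 ≤ M₂) (hrepr : ∀ (v : 𝔸) (j : ι), |b.repr v j| ≤ M₂ * ‖v‖)
    (Rl : Module.End ℝ (SiteY i → 𝔸)) (hRl : ∀ Λ z, Rl Λ z = -(cutMulY (hTY i c) (O (KhY i par (hTY i c) V Λ)) z))
    (S : Finset (IBondY i)) (hS : ∀ a : IBondY i, β i.hN i.D i.hk a ∈ QT i.D (B9GeoLemma21KLevelV1.one_le_Mh i) (four_le_P' i) c → a ∈ S) :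
    HasMajorant (g := toB6 (geo9K i) Rr Hp) (fun p : SiteY i × ι => ιB (blkOf i.D.toDomains p.1)) (conj b Rl)
      (fun a a' => if a ∈ S then M₂ * (∑ j, ‖b j‖) *
          ((B₀ * (((d : ℝ) + 1) * ((1 + (mN : ℝ) * Real.exp δ) * (5 / 8 * C1F d ℓ / i.Mh)
              + (mN : ℝ) * Real.exp δ * ((5 / 8) ^ 2 * C2F d ℓ / (i.Mh : ℝ) ^ 2))
            + ((ℓ : ℝ) + 1) ^ 4 * (sLipT d ℓ / (((ℓ : ℝ) + 1) * i.Mh)))) * ((ℓ : ℝ) + 1) ^ 4) *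
          ((geo9K i).len a * ((geo9K i).len a')⁻¹) * Real.exp (-(δ * (geo9K i).dist a a'))
        else 0) := by
  classical
  obtain ⟨_, hMh2, _, _⟩ := side_conditions i
  have hM : (0 : ℝ) < i.Mh := by exact_mod_cast (lt_of_lt_of_le (by norm_num) hMh2)
  have hC1 : 0 ≤ C1F d ℓ := C1F_nonneg d ℓ
  have hC2 : 0 ≤ C2F d ℓ := C2F_nonneg d ℓ
  have hsL : 0 ≤ sLipT d ℓ := sLipT_nonneg d ℓ
  set θT : ℝ := B₀ * (((d : ℝ) + 1) * ((1 + (mN : ℝ) * Real.exp δ) * (5 / 8 * C1F d ℓ / i.Mh)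
      + (mN : ℝ) * Real.exp δ * ((5 / 8) ^ 2 * C2F d ℓ / (i.Mh : ℝ) ^ 2)) + ((ℓ : ℝ) + 1) ^ 4 * (sLipT d ℓ / (((ℓ : ℝ) + 1) * i.Mh))) with hθT
  have hθT0 : 0 ≤ θT := by positivity
  have hlen0 : ∀ a : IBondY i, 0 ≤ (geo9K i).len a := fun a => (B6KLevelCensusIndexV1.len_pos i a).le
  have hW : ∀ a a' : IBondY i, 0 ≤ (if a ∈ S then θT * ((ℓ : ℝ) + 1) ^ 4 * ((geo9K i).len a * ((geo9K i).len a')⁻¹) *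
      Real.exp (-(δ * (geo9K i).dist a a')) else 0) := fun a a' => by
    split_ifs
    · exact mul_nonneg (mul_nonneg (by positivity) (mul_nonneg (hlen0 a) (inv_nonneg.2 (hlen0 a')))) (Real.exp_pos _).le
    · exact le_rfl
  have hTW : ∀ (f : SiteY i → ℝ) (y y' : IBondY i), (geo9K i).suppIn (Sum.inl f) y' → ∀ E : 𝔸, ‖E‖ ≤ 1 →
      ∀ z : SiteY i, blkOf i.D.toDomains z = β i.hN i.D i.hk y → ‖Rl (liftY f E) z‖
        ≤ (if y ∈ S then θT * ((ℓ : ℝ) + 1) ^ 4 * ((geo9K i).len y * ((geo9K i).len y')⁻¹) * Real.exp (-(δ * (geo9K i).dist y y')) else 0)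
            * (geo9K i).supNorm (Sum.inl f) := by
    intro f y y' hs E hE z hz
    have hF0 : 0 ≤ (geo9K i).supNorm (Sum.inl f) := geo9K_supNorm_nonneg i _
    rw [hRl, norm_neg]
    by_cases h0 : cutMulY (hTY i c) (O (KhY i par (hTY i c) V (liftY f E))) z = 0
    · rw [h0, norm_zero]; exact mul_nonneg (hW y y') hF0
    -- the term is non-zero: `βy ∈ QT □` (so `y ∈ S`, level `≥ j − 1`) and `lvl(y′) ≤ j + 3`
    have hQTz := (mem_QT_of_cutMulY_ne_zero i c _ z h0).1
    rw [hz] at hQTz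
    have hy : y ∈ S := hS y hQTz
    have hlo : c.1.1 ≤ lvl i.hN i.D i.hk y + 1 := by
      have h := lvl_ge_of_mem_QT i c hQTz
      rwa [beta_level i.hN i.D i.hk (le_trans one_le_two i.hk2)] at h
    have hy' : lvl i.hN i.D i.hk y' ≤ c.1.1 + 3 := by
      by_contra hfar
      push Not at hfar
      exact h0 (by rw [KhY_hTY_eq_zero_of_far i V par c hs (liftY f E) (norm_liftY_le f hE) hfar, map_zero, map_zero, Pi.zero_apply])
    rw [if_pos hy]
    have hmain := norm_hTY_O_KhY_apply_le i V O par c hB₀ hδ hη ιB hι hV hTr h342₀ h342₂ T hT hnbr f y y' hs (liftY f E)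
      (norm_liftY_le f hE) z hz
    have hratio : 1 ≤ ((ℓ : ℝ) + 1) ^ 4 * (geo9K i).len y * ((geo9K i).len y')⁻¹ := one_le_pow_four_mul_len_ratio i hη (by omega)
    have hP0 : 0 ≤ θT * Real.exp (-(δ * (geo9K i).dist y y')) * (geo9K i).supNorm (Sum.inl f) := by positivity
    refine hmain.trans ?_
    calc θT * Real.exp (-(δ * (geo9K i).dist y y')) * (geo9K i).supNorm (Sum.inl f)
        = 1 * (θT * Real.exp (-(δ * (geo9K i).dist y y')) * (geo9K i).supNorm (Sum.inl f)) := (one_mul _).symm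
      _ ≤ (((ℓ : ℝ) + 1) ^ 4 * (geo9K i).len y * ((geo9K i).len y')⁻¹) *
            (θT * Real.exp (-(δ * (geo9K i).dist y y')) * (geo9K i).supNorm (Sum.inl f)) := mul_le_mul_of_nonneg_right hratio hP0
      _ = _ := by ring
  have h := OpsYRead342.hasMajorant_conj_of_ball_bound (Rr := Rr) (Hp := Hp) i b Rl (smul_comm_of_eq_transposed i V O par c Rl hRl) ιB hι
    hM₂ hrepr (fun a a' => if a ∈ S then θT * ((ℓ : ℝ) + 1) ^ 4 * ((geo9K i).len a * ((geo9K i).len a')⁻¹) *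
      Real.exp (-(δ * (geo9K i).dist a a')) else 0) hW hTW
  refine hasMajorant_mono (g := toB6 (geo9K i) Rr Hp) _ h fun a a' => le_of_eq ?_
  show M₂ * (∑ j, ‖b j‖) * (if a ∈ S then θT * ((ℓ : ℝ) + 1) ^ 4 * ((geo9K i).len a * ((geo9K i).len a')⁻¹) *
      Real.exp (-(δ * (geo9K i).dist a a')) else 0) = _
  split_ifs
  · ring
  · rw [mul_zero]

end Majorant

/-! ## §2 ★★ Theorem 3.7 ⇒ the (3.42) block of the reading of `G′(U)` over the class, the transposed commutator majorants DISCHARGED -/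

section Cubes

variable [Fintype (geo9K i).Site] [DecidableEq (geo9K i).Site] {Rr : ℝ} {Hp : Prop}
variable {B : B9.Backgrounds} (cfg : B.Cfg → CfgY 𝔸 i) (parS : SiteParY 𝔸 i) {U₁ : B.Cfg}

/-- ★★ **THEOREM 3.7 ⇒ ALL FOUR INEQUALITIES (3.42) FOR `G′(U)` AT THE CUBE COVER OF RECORD, THE TRANSPOSED COMMUTATOR TERMS CONCRETE.**  As FILE 4c's
`eBlock_kernelFamilySInv_Gp_of_cubeCover`, with the family `V_□Λ := −h_□O_□(K(h_□)Λ)` (`hVt`) and its scale-weighted block majorants now SUPPLIED by §1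
(`θ_V = 3·5^{d+1}·M₂(Σ‖b_j‖)·θ_T·L⁴`, FILE 5a's `θ_T`); displayed: the cube letters' Cor-3.6 blocks over the class (`hE`), `R_□ = K(h_□)O_□h_□` (`hR`),
`G′Δ′_a = 1` (`hinv`), (3.88) (`h388`) and its transposed reading `(Σ_□h_□O_□h_□)Δ′ = 1 − Σ_□V_□` (`h388T`), bi-contraction at `U₁`, `η = |c_f|⁻¹`, the
section `ιB`, the basis `b` with `M₂`, the neighbourhood count `m_N`, [4] Lemma 2.1 at exponent `α`, and the two located smallness conditions.
[cite: Balaban1985BackgroundPropagators, Thm 3.7 (3.87)–(3.90) pp.409–410 ⇒ Thm 3.1 (3.42) p.397, Cor. 3.6 p.408; Balaban1984PropagatorsII, Prop 2.2 (2.65)–(2.67) p.234, Lemma 2.1 (2.61) p.234] -/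
theorem eBlock_kernelFamilySInv_Gp_of_cubeCover' (ιB : BlkY i → IBondY i) (hι : ∀ s, β i.hN i.D i.hk (ιB s) = s)
    {M₂ : ℝ} (hM₂ : 0 ≤ M₂) (hrepr : ∀ (v : 𝔸) (j : ι), |b.repr v j| ≤ M₂ * ‖v‖) (hη : etaS i = |i.cf|⁻¹)
    (Gp : SiteOpY 𝔸 i) (Oc : ↥(cubes i.D.toDomains) → SiteOpY 𝔸 i) {Δ : Module.End ℝ (SiteY i → 𝔸)}
    (R Vt : ↥(cubes i.D.toDomains) → Module.End ℝ (SiteY i → 𝔸))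
    (hR : ∀ c Λ, R c Λ = KhY i parS (hTY i c) (cfg U₁) (Oc c (cfg U₁) (cutMulY (hTY i c) Λ)))
    (hVt : ∀ c Λ z, Vt c Λ z = -(cutMulY (hTY i c) (Oc c (cfg U₁) (KhY i parS (hTY i c) (cfg U₁) Λ)) z))
    (hinv : (Gp (cfg U₁)).restrictScalars ℝ * Δ = 1)
    (h388 : Δ * (∑ c, (cutMulY (𝔸 := 𝔸) (hTY i c)).restrictScalars ℝ * (Oc c (cfg U₁)).restrictScalars ℝ *
      (cutMulY (𝔸 := 𝔸) (hTY i c)).restrictScalars ℝ) = 1 - ∑ c, R c)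
    (h388T : (∑ c, (cutMulY (𝔸 := 𝔸) (hTY i c)).restrictScalars ℝ * (Oc c (cfg U₁)).restrictScalars ℝ *
      (cutMulY (𝔸 := 𝔸) (hTY i c)).restrictScalars ℝ) * Δ = 1 - ∑ c, Vt c)
    {B₀ δ₀ : ℝ} (hB₀ : 0 ≤ B₀) (hδ₀ : 0 ≤ δ₀) (hE : ∀ c, EBlock (kernelFamilySInv i B cfg (Oc c) parS) B₀ δ₀ U₁)
    (hVb : ∀ (μ : Fin (d + 1)) (x : SiteY i), ‖(UboxY i (cfg U₁) μ x : 𝔸)‖ ≤ 1 ∧ ‖(((UboxY i (cfg U₁) μ x)⁻¹ : 𝔸ˣ) : 𝔸)‖ ≤ 1)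
    (hTr : ∀ z w : SiteY i, ‖(avgTrY i parS (cfg U₁) z w : 𝔸)‖ ≤ 1 ∧ ‖(((avgTrY i parS (cfg U₁) z w)⁻¹ : 𝔸ˣ) : 𝔸)‖ ≤ 1)
    (Tn : IBondY i → Finset (IBondY i)) (hTn : ∀ a y' : IBondY i, (geo9K i).dist a y' ≤ 1 → a ∈ Tn y')
    {mN : ℕ} (hnbr : ∀ y' : IBondY i, (Tn y').card ≤ mN)
    (d' : ℕ) {α : ℝ} (hαδ : 0 ≤ α * δ₀) (hαδ2 : 0 ≤ (1 - 2 * α) * δ₀)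
    (h261 : Ineq261 d' (toB6 (geo9K i) Rr Hp) δ₀ α) (h263 : Ineq263 d' (toB6 (geo9K i) Rr Hp) δ₀ α)
    (hsmall : (3 * 5 ^ (d + 1)) * (M₂ * (∑ j, ‖b j‖) * (theta389 d ℓ B₀ δ₀ / (((ℓ : ℝ) + 1) * i.Mh))) * B6.c1 d' δ₀ α < 1)
    (hsmallV : (3 * 5 ^ (d + 1)) * (M₂ * (∑ j, ‖b j‖) *
      ((B₀ * (((d : ℝ) + 1) * ((1 + (mN : ℝ) * Real.exp δ₀) * (5 / 8 * C1F d ℓ / i.Mh)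
          + (mN : ℝ) * Real.exp δ₀ * ((5 / 8) ^ 2 * C2F d ℓ / (i.Mh : ℝ) ^ 2))
        + ((ℓ : ℝ) + 1) ^ 4 * (sLipT d ℓ / (((ℓ : ℝ) + 1) * i.Mh)))) * ((ℓ : ℝ) + 1) ^ 4)) * B6.c1 d' δ₀ α < 1) :
    EBlock (kernelFamilySInv i B cfg Gp parS)
      (M₂ * (∑ j, ‖b j‖) *
        ((3 * 5 ^ (d + 1)) * (M₂ * (∑ j, ‖b j‖) * B₀) * B6.c1 d' δ₀ α *
            (1 - (3 * 5 ^ (d + 1)) * (M₂ * (∑ j, ‖b j‖) * (theta389 d ℓ B₀ δ₀ / (((ℓ : ℝ) + 1) * i.Mh))) * B6.c1 d' δ₀ α)⁻¹ +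
          (3 * 5 ^ (d + 1)) * (M₂ * (∑ j, ‖b j‖) * (B₀ * (1 + 5 / 8 * C1F d ℓ / i.Mh))) * B6.c1 d' δ₀ α *
            (1 - (3 * 5 ^ (d + 1)) * (M₂ * (∑ j, ‖b j‖) * (theta389 d ℓ B₀ δ₀ / (((ℓ : ℝ) + 1) * i.Mh))) * B6.c1 d' δ₀ α)⁻¹ +
          (3 * 5 ^ (d + 1)) * (M₂ * (∑ j, ‖b j‖) * (B₀ * (1 + (mN : ℝ) * Real.exp δ₀ * (5 / 8 * C1F d ℓ / i.Mh)))) * B6.c1 d' δ₀ α *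
            (1 - (3 * 5 ^ (d + 1)) * (M₂ * (∑ j, ‖b j‖) *
              ((B₀ * (((d : ℝ) + 1) * ((1 + (mN : ℝ) * Real.exp δ₀) * (5 / 8 * C1F d ℓ / i.Mh)
                  + (mN : ℝ) * Real.exp δ₀ * ((5 / 8) ^ 2 * C2F d ℓ / (i.Mh : ℝ) ^ 2))
                + ((ℓ : ℝ) + 1) ^ 4 * (sLipT d ℓ / (((ℓ : ℝ) + 1) * i.Mh)))) * ((ℓ : ℝ) + 1) ^ 4)) * B6.c1 d' δ₀ α)⁻¹ +
          (3 * 5 ^ (d + 1)) * (M₂ * (∑ j, ‖b j‖) * (B₀ + theta389 d ℓ B₀ δ₀ / (((ℓ : ℝ) + 1) * i.Mh))) * B6.c1 d' δ₀ α *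
            (1 - (3 * 5 ^ (d + 1)) * (M₂ * (∑ j, ‖b j‖) * (theta389 d ℓ B₀ δ₀ / (((ℓ : ℝ) + 1) * i.Mh))) * B6.c1 d' δ₀ α)⁻¹))
      ((1 - 2 * α) * δ₀) U₁ := by
  obtain ⟨_, hMh2, _, _⟩ := side_conditions i
  have hM : (0 : ℝ) < i.Mh := by exact_mod_cast (lt_of_lt_of_le (by norm_num) hMh2)
  have hC1 : 0 ≤ C1F d ℓ := C1F_nonneg d ℓ
  have hC2 : 0 ≤ C2F d ℓ := C2F_nonneg d ℓ
  have hsL : 0 ≤ sLipT d ℓ := sLipT_nonneg d ℓ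
  have hSb : 0 ≤ ∑ j, ‖b j‖ := Finset.sum_nonneg fun _ _ => norm_nonneg _
  have hN : (0 : ℝ) ≤ 3 * 5 ^ (d + 1) := by positivity
  have hθV' : 0 ≤ M₂ * (∑ j, ‖b j‖) *
      ((B₀ * (((d : ℝ) + 1) * ((1 + (mN : ℝ) * Real.exp δ₀) * (5 / 8 * C1F d ℓ / i.Mh)
          + (mN : ℝ) * Real.exp δ₀ * ((5 / 8) ^ 2 * C2F d ℓ / (i.Mh : ℝ) ^ 2))
        + ((ℓ : ℝ) + 1) ^ 4 * (sLipT d ℓ / (((ℓ : ℝ) + 1) * i.Mh)))) * ((ℓ : ℝ) + 1) ^ 4) := by positivity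
  have hθV : 0 ≤ (3 * 5 ^ (d + 1)) * (M₂ * (∑ j, ‖b j‖) *
      ((B₀ * (((d : ℝ) + 1) * ((1 + (mN : ℝ) * Real.exp δ₀) * (5 / 8 * C1F d ℓ / i.Mh)
          + (mN : ℝ) * Real.exp δ₀ * ((5 / 8) ^ 2 * C2F d ℓ / (i.Mh : ℝ) ^ 2))
        + ((ℓ : ℝ) + 1) ^ 4 * (sLipT d ℓ / (((ℓ : ℝ) + 1) * i.Mh)))) * ((ℓ : ℝ) + 1) ^ 4)) := mul_nonneg hN hθV'
  -- the cube letters' (3.42)₁,₃ entries over the class, READ pointwise (D1 §3)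
  have h342₀ : ∀ (c : ↥(cubes i.D.toDomains)) (f : SiteY i → ℝ) (y y' : IBondY i), (geo9K i).suppIn (Sum.inl f) y' →
      ∀ Λ : SiteY i → 𝔸, (∀ z, ‖Λ z‖ ≤ |f z|) → ∀ z : SiteY i, blkOf i.D.toDomains z = β i.hN i.D i.hk y →
        etaS i ^ 2 * ‖Oc c (cfg U₁) Λ z‖ ≤ B₀ * (geo9K i).len y ^ 2 * Real.exp (-(δ₀ * (geo9K i).dist y y')) * (geo9K i).supNorm (Sum.inl f) :=
    fun c f y y' hs Λ hΛ z hz => sq_eta_mul_norm_le_of_eBlockInv i b cfg (Oc c) parS (hE c) hM₂ hrepr f y y' hs ⟨Λ, hΛ⟩ hz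
  have h342₂ : ∀ (c : ↥(cubes i.D.toDomains)) (f : SiteY i → ℝ) (y y' : IBondY i), (geo9K i).suppIn (Sum.inl f) y' →
      ∀ Λ : SiteY i → 𝔸, (∀ z, ‖Λ z‖ ≤ |f z|) → ∀ (z : SiteY i) (μ : Fin (d + 1)), blkOf i.D.toDomains z = β i.hN i.D i.hk y →
        etaS i * ‖Oc c (cfg U₁) (cdsS i (cfg U₁) μ Λ) z‖
          ≤ B₀ * (geo9K i).len y * Real.exp (-(δ₀ * (geo9K i).dist y y')) * (geo9K i).supNorm (Sum.inl f) :=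
    fun c f y y' hs Λ hΛ z μ hz => eta_mul_norm_cdsS_le_of_eBlockInv i b cfg (Oc c) parS (hE c) hM₂ hrepr f y y' hs ⟨Λ, hΛ⟩ μ hz
  -- the transposed commutator majorants, cube by cube (§1), and their scale-weighted overlap sum
  have hV : ∀ c, HasMajorant (g := toB6 (geo9K i) Rr Hp) (fun p : SiteY i × ι => ιB (blkOf i.D.toDomains p.1)) (conj b (Vt c))
      (fun a a' => if a ∈ SQT i c then M₂ * (∑ j, ‖b j‖) *
          ((B₀ * (((d : ℝ) + 1) * ((1 + (mN : ℝ) * Real.exp δ₀) * (5 / 8 * C1F d ℓ / i.Mh)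
              + (mN : ℝ) * Real.exp δ₀ * ((5 / 8) ^ 2 * C2F d ℓ / (i.Mh : ℝ) ^ 2))
            + ((ℓ : ℝ) + 1) ^ 4 * (sLipT d ℓ / (((ℓ : ℝ) + 1) * i.Mh)))) * ((ℓ : ℝ) + 1) ^ 4) *
          ((geo9K i).len a * ((geo9K i).len a')⁻¹) * Real.exp (-(δ₀ * (geo9K i).dist a a'))
        else 0) := fun c => by
    convert hasMajorant_conj_transposedComm i b (cfg U₁) (Oc c (cfg U₁)) parS (Rr := Rr) (Hp := Hp) c hB₀ hδ₀ hη ιB hι hVb hTr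
      (h342₀ c) (h342₂ c) Tn hTn hnbr hM₂ hrepr (Vt c) (hVt c) (SQT i c) (fun a ha => (mem_SQT i c a).2 ha) using 3
    split_ifs <;> first | rfl | contradiction
  have hKV : ∀ (a a' : (geo9K i).Site),
      (∑ c : ↥(cubes i.D.toDomains), (if a ∈ SQT i c then M₂ * (∑ j, ‖b j‖) *
          ((B₀ * (((d : ℝ) + 1) * ((1 + (mN : ℝ) * Real.exp δ₀) * (5 / 8 * C1F d ℓ / i.Mh)
              + (mN : ℝ) * Real.exp δ₀ * ((5 / 8) ^ 2 * C2F d ℓ / (i.Mh : ℝ) ^ 2))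
            + ((ℓ : ℝ) + 1) ^ 4 * (sLipT d ℓ / (((ℓ : ℝ) + 1) * i.Mh)))) * ((ℓ : ℝ) + 1) ^ 4) *
          ((geo9K i).len a * ((geo9K i).len a')⁻¹) * Real.exp (-(δ₀ * (geo9K i).dist a a'))
        else 0))
        ≤ (3 * 5 ^ (d + 1)) * (M₂ * (∑ j, ‖b j‖) *
            ((B₀ * (((d : ℝ) + 1) * ((1 + (mN : ℝ) * Real.exp δ₀) * (5 / 8 * C1F d ℓ / i.Mh)
                + (mN : ℝ) * Real.exp δ₀ * ((5 / 8) ^ 2 * C2F d ℓ / (i.Mh : ℝ) ^ 2))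
              + ((ℓ : ℝ) + 1) ^ 4 * (sLipT d ℓ / (((ℓ : ℝ) + 1) * i.Mh)))) * ((ℓ : ℝ) + 1) ^ 4))
          * (geo9K i).len a * ((geo9K i).len a')⁻¹ * Real.exp (-(δ₀ * (geo9K i).dist a a')) := fun a a' => by
    have hl := (B6KLevelCensusIndexV1.len_pos i a).le
    have hl' := inv_nonneg.2 (B6KLevelCensusIndexV1.len_pos i a').le
    exact (sum_ite_SQT_le i a (by positivity)).trans (le_of_eq (by ring))
  exact eBlock_kernelFamilySInv_Gp_of_cubeCover i b cfg parS ιB hι hM₂ hrepr hη Gp Oc R Vt hR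
    (fun c a a' => if a ∈ SQT i c then M₂ * (∑ j, ‖b j‖) *
          ((B₀ * (((d : ℝ) + 1) * ((1 + (mN : ℝ) * Real.exp δ₀) * (5 / 8 * C1F d ℓ / i.Mh)
              + (mN : ℝ) * Real.exp δ₀ * ((5 / 8) ^ 2 * C2F d ℓ / (i.Mh : ℝ) ^ 2))
            + ((ℓ : ℝ) + 1) ^ 4 * (sLipT d ℓ / (((ℓ : ℝ) + 1) * i.Mh)))) * ((ℓ : ℝ) + 1) ^ 4) *
          ((geo9K i).len a * ((geo9K i).len a')⁻¹) * Real.exp (-(δ₀ * (geo9K i).dist a a'))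
        else 0)
    hinv h388 h388T hB₀ hδ₀ hE hVb hTr
    Tn hTn hnbr d' hθV hαδ hαδ2 h261 h263 hsmall hsmallV hV hKV

end Cubes

end Literature.MathematicalPhysics.QuantumFieldTheory.Balaban1983to89.B9Thm37TransposedCommutatorMajorant

end
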